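import Summits.HodgeConjecture.HodgeConjecture.Theorems.Ring2AtlasCMThreefoldsCyclotomic21
import Summits.HodgeConjecture.HodgeConjecture.Theorems.Ring2AtlasCMThreefoldsCyclotomic9
import Summits.HodgeConjecture.HodgeConjecture.Theorems.Ring2AtlasUnitaryProductCellsNonVacuity
import Summits.HodgeConjecture.CorCM.Model.CMAbelianVarietyRealisedHolds
import Literature.NumberTheory.ComplexMultiplication.ShimuraTaniyamaHecke
import Literature.AlgebraicGeometry.Milne1999.CMTypeSimpleIsogenyFactors
import Literature.AlgebraicGeometry.Pohlmann1968.SimpleCMAbelianVarietyPowersDivisorGenerated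
import Mathlib.LinearAlgebra.FiniteDimensional.Lemmas
import HarnessLib

set_option linter.dupNamespace false

/-!
# Ring 2 · atlas-2 — the OPEN `Y₃ × Y₃'` cell is NOT VACUOUS on its CM locus

HONEST FRAMING: research route conditional on HC_CM; not a corollary; Q11.4-sentence-2 already refuted in dim ≥ 3.

Cell `pub-hodge-ring2`, seat `pub-hodge-ring2-atlas-2` (generation 53). The typed `g = 6` cell
`HodgeUnitaryThreefoldPair` of `Ring2AtlasSixfolds` §3 — `Y × Y'` with `Y`, `Y'` NON-ISOGENOUS simple abelian
threefolds each carrying `ψ` with `ψ ∘ ψ = -d` (`d > 0`) — is an OPEN statement about a typed class (its word is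
«open», `Ring2AtlasSixfolds`; its CM locus follows from `HC_CM`, `Ring2AtlasUnitaryProductCellsNonVacuity` §1).
What the tree lacked (generation 52 HANDOFF, 6 (ii)) is a KERNEL proof that the class is INHABITED — that the
cell `def` is not a statement about the empty set. This file supplies it on the cell's CM locus, with `d = 3`,
and OUTRIGHT (no hypothesis): the realisation record `PicardCM.CMAbelianVarietyRealised` (H₃) is a tree theorem,
`CorCM.cmAbelianVarietyRealised_holds` (the complex-torus model), imported by name, never restated.

THE WITNESS. `Y` := any realisation of the primitive CM type `(ℚ(ζ₉); {1, 2, 4})`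
(`Ring2AtlasCMThreefoldsCyclotomic9`), `Y'` := any realisation of the primitive CM type `(K; S)`,
`K = ℚ(ζ₂₁)^⟨ζ ↦ ζ¹³⟩ = ℚ(ζ₃, ζ₇ + ζ₇⁻¹)` (`Ring2AtlasCMThreefoldsCyclotomic21` and §0 below). Both are simple
abelian THREEFOLDS of CM type (Shimura–Taniyama §8.2 Prop. 26 = the tree's
`isSimple_of_isCMTypeRealisation_of_primitive`; `[ℚ(ζ₉) : ℚ] = [K : ℚ] = 6`); both CM fields contain
`ω = ζ₃`, so `ψ := ι(2ω + 1)`, `ψ' := ι'(2ω + 1)` square to `-3` (`Cyclotomic3.two_mul_add_one_mul_self`,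
generation 50). NON-ISOGENY (§1): an isogeny `Y → Y'` would give `End⁰(Y) ↪ End⁰(Y')` (Mumford §19, the tree's
`AbelianVariety.IsIsogeny.exists_algHom_injective`), hence a ring map
`ℚ(ζ₉) → End⁰(Y) ≃ End⁰(Y') = K ⊂ ℚ(ζ₂₁)` (`ℚ(ζ₉) → End⁰(Y)` by Serre–Tate / Shimura §5.1, the tree's
`exists_ringHom_endAlgebra`; `End⁰(Y') = K` because `Y'` is simple of CM type, Shimura §5.1 Props. 3, 4, 6 =
`Milne1999.IsOfCMType.isOfCMTypeSimple` plus the degree count `6 = 6`) — and `ℚ(ζ₂₁)` contains no primitive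
9th root of unity (`Cyclotomic21.not_nonempty_ringHom_cyclotomicNine`: `lcm(9, 21) = 63`, `φ(63) = 36 > 12`).

Proved here: §0 the type `S` of `K` and its primitivity (layout of `Cyclotomic33`, generation 52: exponent set
`T = {1, 2, 4, 5, 10, 13} ⊂ (ℤ/21)^×`, the three `H`-cosets of `2⁰, 2¹, 2²`, `H = {1, 13}`; `core_prim`:
the stabiliser of `T` is exactly `H`, `decide +kernel`); §1 `End⁰ = K` for a simple principal realisation
(`nonempty_ringEquiv_endAlgebra_of_isSimple`) and «isogenous ⇒ a ring map between the CM fields»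
(`nonempty_ringHom_of_isIsogenous`); §2 `hodgeUnitaryThreefoldPair_class_nonempty` (given H₃) and
`hodgeUnitaryThreefoldPair_class_nonempty'` (OUTRIGHT): `∃ Y Y' ψ ψ' d` with EVERY binder of the cell and
`IsOfCMType Y ∧ IsOfCMType Y'`; hence `HodgeUnitaryThreefoldPair.exists_cmSixfold` (the cell, if proved, yields an
actual CM abelian sixfold satisfying HC — it does not quantify over nothing) and
`hodgeUnitaryThreefoldPair_cmLocus_nonempty_of_cmAbelianHodge` (under HC_CM — an explicit hypothesis — HC holds
for an actual member of the cell's class, by generation 50's `hodgeUnitaryThreefoldPair_cmLocus_of_cmAbelianHodge`).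
After this file all three unitary-product cells of `Ring2AtlasSixfolds` §3 (v) have kernel-inhabited CM loci
(`E × X₅` and `E² × X₄`: generation 50 / 52; `Y₃ × Y₃'`: here).

WHAT THIS IS NOT: not a proof of the cell (`HodgeUnitaryThreefoldPair` stays OPEN: the generic member has
`Y`, `Y'` NOT of CM type, where [MoonenZarhin1999, Thm. 0.1 (iv)] puts exceptional Weil classes on `Y × Y'`
and nothing in print or in the tree decides them); not a status-word change (no «open» moves, no count, no
KIND); not a corollary of HC_CM for the cell's generic member; nothing about fourfolds, fivefolds or the
Weil-type sixfold rows. `HC_CM` (`Theses.RankFourFaces.CMAbelianHodge`) appears only as the explicit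
ARGUMENT of the one theorem that uses it.

References: [Shimura1998] G. Shimura, *Abelian Varieties with Complex Multiplication and Modular Functions*,
Princeton Univ. Press (1998), §5.1 Props. 3, 4, 6, §8.2 Prop. 26, §8.4 Example (1); [SerreTate1968] J.-P. Serre,
J. Tate, *Good reduction of abelian varieties*, Ann. of Math. 88 (1968), §4; [MumfordAV1970] D. Mumford,
*Abelian Varieties* (1970), §19 Cor. 1–2 of Thm. 3 and pp. 172–174; [Milne1999] J. S. Milne, *Lefschetz motives
and the Tate conjecture*, Compositio Math. 117 (1999), §2 p. 54; [MoonenZarhin1999] B. Moonen, Yu. Zarhin, Duke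
Math. J. 97 (1999), Thm. 0.1 (iv) and §6.
-/

noncomputable section

open Polynomial NumberField CategoryTheory

namespace Summit.HodgeConjecture.HodgeConjecture.Ring2.Atlas

open Literature.AlgebraicGeometry Literature.AlgebraicGeometry.Motives
open Literature.AlgebraicGeometry.HodgeTheory (HodgeConjectureFor complexBetti)
open Literature.AlgebraicGeometry.ComplexMultiplication
open Literature.NumberTheory.ComplexMultiplication
open Literature.NumberTheory.Automorphic (PicardCM.CMAbelianVarietyRealised)
open Literature.AlgebraicGeometry.Milne1999 (IsOfCMType IsOfCMTypeSimple)
open Literature.AlgebraicGeometry.Pohlmann1968 (finrank_eq_two_mul_dim_of_isCMTypeRealisation)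
open Summit.HodgeConjecture.CorCM (cmAbelianVarietyRealised_holds)

namespace Cyclotomic21

/-! ## §0 The CM type `S` of `K = ℚ(ζ₂₁)^⟨σ⟩`, read on `ℚ(ζ₂₁)`: exponents in `T` -/

/-- The exponent set of the type, `T ⊂ (ℤ/21)^×`: the union of the three `H`-cosets `2^i·H`, `0 ≤ i ≤ 2`
(`H = {1, 13}`), i.e. the first half `{ḡ⁰, ḡ¹, ḡ²}` of the cyclic group `Gal(K/ℚ) = (ℤ/21)^×/H ≅ ℤ/6` in the
generator `ḡ = 2̄` — Shimura's half-system for a field cyclic over `ℚ`. Listed as residues.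
[cite: Shimura1998, §8.4 Example (1), p. 64] -/
def expT : List ℕ := [1, 2, 4, 5, 10, 13]

/-- `T` is a union of `H`-cosets: `a·13^j ∈ T ⟺ a ∈ T` (membership read on residues mod `21`). Decided by
the kernel. [folklore] -/
theorem core_T13 : ∀ a : ℕ, a < 21 → ∀ j : ℕ, j < 2 → ((a * 13 ^ j) % 21 ∈ expT ↔ a % 21 ∈ expT) := by
  decide +kernel

/-- `T ⊔ (−T) = (ℤ/21)^×`: for a unit `a`, exactly one of `a`, `−a ≡ 20a` lies in `T` («no two of the `φᵢ`
are complex conjugate of each other»). Decided by the kernel. [folklore] -/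
theorem core_conj : ∀ a : ℕ, a < 21 → a.Coprime 21 → (a % 21 ∈ expT ↔ ¬ (20 * a) % 21 ∈ expT) := by
  decide +kernel

/-- `(ℤ/21)^×` is a group of order `12`: `a · (a¹¹ b) ≡ b (mod 21)` for `a` prime to `21` (Euler).
Decided by the kernel. [folklore] -/
theorem core_inv : ∀ a : ℕ, a < 21 → a.Coprime 21 → ∀ b : ℕ, b < 21 →
    (a * (a ^ 11 * b % 21)) % 21 = b := by
  decide +kernel

/-- Products of units mod `21` are units. Decided by the kernel. [folklore] -/
theorem core_coprime : ∀ c : ℕ, c < 21 → c.Coprime 21 → ∀ a : ℕ, a < 21 → a.Coprime 21 →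
    Nat.Coprime (c * a) 21 := by
  decide +kernel

set_option synthInstance.maxSize 4096 in
set_option synthInstance.maxHeartbeats 400000 in
/-- **The arithmetic heart of primitivity** (Shimura's `H' = H₁`, §8.2 Prop. 26, for this type): if two
units `a, b` mod `21` satisfy `ca ∈ T ⟺ cb ∈ T` for every unit `c`, then `b ∈ aH = {a, 13a}` — the
stabiliser `{γ : γT = T}` of `T` in `(ℤ/21)^×` is exactly `H` (an «interval» `{ḡ⁰, ḡ¹, ḡ²}` of `ℤ/6` has
trivial stabiliser), applied to `b a⁻¹`. In particular the type is NOT one of the two types of `K` induced from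
`ℚ(√-3)` (whose stabiliser is the index-`2` subgroup). Decided by the kernel on the full residue table.
[cite: Shimura1998, §8.2 Prop. 26, p. 61; §8.4, p. 64] -/
theorem core_prim : ∀ a : ℕ, a < 21 → a.Coprime 21 → ∀ b : ℕ, b < 21 → b.Coprime 21 →
    (∀ c : ℕ, c < 21 → c.Coprime 21 → ((c * a) % 21 ∈ expT ↔ (c * b) % 21 ∈ expT)) →
    (b = a ∨ b = a * 13 % 21) := by
  decide +kernel

/-- **The type** `S ⊂ Hom(K, ℂ)`: the complex embeddings of `K` one (equivalently every) extension of which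
to `ℚ(ζ₂₁)` sends `ζ` to `μ^a` with `a ∈ T` (well defined because `T` is `H`-stable, `mem_typeSet_iff`).
[cite: Shimura1998, §8.4 Example (1), p. 64] -/
def typeSet : Set (K6 →+* ℂ) :=
  {φ | ∃ f : L21 →+* ℂ, f.comp (algebraMap K6 L21) = φ ∧ ∃ a : ℕ, a < 21 ∧ f ζ = μ ^ a ∧ a % 21 ∈ expT}

/-- Membership in the type is read off the exponent of ANY extension to `ℚ(ζ₂₁)` (two extensions differ by
an element of `H`, and `T` is `H`-stable). [folklore] -/
theorem mem_typeSet_iff {φ : K6 →+* ℂ} {f : L21 →+* ℂ} (hf : f.comp (algebraMap K6 L21) = φ)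
    {n : ℕ} (hn : f ζ = μ ^ n) : φ ∈ typeSet ↔ n % 21 ∈ expT := by
  constructor
  · rintro ⟨f', hf', a, ha, hf'a, hTa⟩
    obtain ⟨j, hj, hjζ⟩ := exists_exponent_of_comp_eq (hf'.trans hf.symm) hf'a
    have hmod : n % 21 = (a * 13 ^ j) % 21 :=
      μ_pow_inj (Nat.mod_lt _ (by norm_num)) (Nat.mod_lt _ (by norm_num))
        (by rw [← μ_pow_mod, ← μ_pow_mod, ← hn, hjζ])
    rw [hmod, core_T13 a ha j hj]
    exact hTa
  · intro hT
    exact ⟨f, hf, n % 21, Nat.mod_lt _ (by norm_num), by rw [hn, μ_pow_mod n], by rwa [Nat.mod_mod]⟩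

/-- **`(K; S)` is a CM type**: an embedding lies in `S` iff its complex conjugate does not (the conjugate of
an extension extends the conjugate and has exponent `20a = −a`, and `T ⊔ (−T) = (ℤ/21)^×`).
[cite: Shimura1998, §8.4 Example (1), p. 64] -/
theorem typeSet_isCMType (φ : K6 →+* ℂ) : φ ∈ typeSet ↔ ComplexEmbedding.conjugate φ ∉ typeSet := by
  obtain ⟨f, hf⟩ := exists_extension φ
  obtain ⟨a, ha, hac, hfa⟩ := exists_apply_ζ_eq f
  have hconj : (ComplexEmbedding.conjugate f).comp (algebraMap K6 L21) = ComplexEmbedding.conjugate φ := by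
    ext x
    have hx := RingHom.congr_fun hf x
    rw [RingHom.comp_apply] at hx
    rw [RingHom.comp_apply, ComplexEmbedding.conjugate_coe_eq, hx, ← ComplexEmbedding.conjugate_coe_eq]
  have h20 : ComplexEmbedding.conjugate f ζ = μ ^ (20 * a) := by
    rw [ComplexEmbedding.conjugate_coe_eq, hfa, map_pow, conj_μ, ← pow_mul]
  rw [mem_typeSet_iff hf hfa, mem_typeSet_iff hconj h20]
  exact core_conj a ha hac

/-- **The CM type `(K; S)` of the factor `Y'`** as a `Motives.CMType`: `K = ℚ(ζ₂₁)^⟨σ⟩` cyclic of degree `6`,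
`S` = the three embeddings whose extensions have exponent in `T`. [cite: Shimura1998, §8.4 Example (1), p. 64] -/
def Φ : CMType K6 := ⟨typeSet, typeSet_isCMType⟩

/-- **The CM type `(K; S)` is PRIMITIVE** (Shimura 1998 §8.2 Prop. 26: `(F; {φᵢ})` is primitive iff
`H₁ = H'`; here `H₁ = H = ⟨σ⟩` and `H' = {γ : γT = T} = H` by `core_prim`), in the `Aut(ℂ)`-form consumed by
the tree's simplicity criterion `ComplexMultiplication.isSimple_of_isCMTypeRealisation_of_primitive`: two complex
embeddings `s, t` of `K` with `τ ∘ s ∈ S ⟺ τ ∘ t ∈ S` for all `τ ∈ Aut(ℂ)` coincide. Proof as in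
`Cyclotomic33.Φ_primitive`: extend `s, t` to `fₛ, fₜ : ℚ(ζ₂₁) → ℂ` with exponents `a, b`; moving `fₛ` to the
embedding `ζ ↦ μ^{ca}` by some `τ ∈ Aut(ℂ)` (`exists_ringEquiv_comp_eq`) turns the hypothesis into
`ca ∈ T ⟺ cb ∈ T` for every unit `c` (`mem_typeSet_iff`), so `b ≡ a·13^j` (`core_prim`), `fₜ = fₛ ∘ σ^j`
(`ringHom_ext_ζ`), and `σ^j ∈ H` fixes `K` pointwise, whence `t = s`.
[cite: Shimura1998, §8.2 Prop. 26, p. 61; §8.4 Example (1), p. 64] -/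
theorem Φ_primitive (s t : K6 →+* ℂ)
    (hst : ∀ τ : ℂ ≃+* ℂ, ((τ : ℂ →+* ℂ).comp s ∈ Φ.1 ↔ (τ : ℂ →+* ℂ).comp t ∈ Φ.1)) : s = t := by
  obtain ⟨fs, hfs⟩ := exists_extension s
  obtain ⟨ft, hft⟩ := exists_extension t
  obtain ⟨a, ha, hac, hfsa⟩ := exists_apply_ζ_eq fs
  obtain ⟨b, hb, hbc, hftb⟩ := exists_apply_ζ_eq ft
  -- `ft ζ` is a power of `fs ζ`
  obtain ⟨k, hk⟩ : ∃ k : ℕ, (a * k) % 21 = b := ⟨a ^ 11 * b % 21, core_inv a ha hac b hb⟩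
  have hftζ : ft ζ = (fs ζ) ^ k := by
    rw [hftb, hfsa, ← pow_mul, μ_pow_mod (a * k), hk]
  -- the pattern hypothesis, read on exponents
  have key : ∀ c : ℕ, c < 21 → c.Coprime 21 → ((c * a) % 21 ∈ expT ↔ (c * b) % 21 ∈ expT) := by
    intro c hc hcc
    obtain ⟨g, hg⟩ := exists_embedding_apply_ζ_eq (core_coprime c hc hcc a ha hac)
    obtain ⟨τ, hτ⟩ := exists_ringEquiv_comp_eq fs g
    have h1 : ((τ : ℂ →+* ℂ).comp fs) ζ = μ ^ (c * a) := by
      simp only [RingHom.coe_comp, RingHom.coe_coe, Function.comp_apply, hτ, hg]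
    have h2 : ((τ : ℂ →+* ℂ).comp ft) ζ = μ ^ (c * a * k) := by
      simp only [RingHom.coe_comp, RingHom.coe_coe, Function.comp_apply, hftζ, map_pow, hτ, hg, ← pow_mul]
    have hmod : (c * a * k) % 21 = (c * b) % 21 := by
      rw [mul_assoc, Nat.mul_mod, hk, Nat.mul_mod c b, Nat.mod_eq_of_lt hb]
    have e1 : ((τ : ℂ →+* ℂ).comp fs).comp (algebraMap K6 L21) = (τ : ℂ →+* ℂ).comp s := by
      rw [RingHom.comp_assoc, hfs]
    have e2 : ((τ : ℂ →+* ℂ).comp ft).comp (algebraMap K6 L21) = (τ : ℂ →+* ℂ).comp t := by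
      rw [RingHom.comp_assoc, hft]
    have hτst := hst τ
    change ((τ : ℂ →+* ℂ).comp s ∈ typeSet ↔ (τ : ℂ →+* ℂ).comp t ∈ typeSet) at hτst
    rw [mem_typeSet_iff e1 h1, mem_typeSet_iff e2 h2, hmod] at hτst
    exact hτst
  obtain ⟨j, hjb⟩ : ∃ j : ℕ, b = (a * 13 ^ j) % 21 := by
    rcases core_prim a ha hac b hb hbc key with h | h
    · exact ⟨0, by rw [pow_zero, mul_one, Nat.mod_eq_of_lt ha]; exact h⟩
    · exact ⟨1, by rw [pow_one]; exact h⟩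
  -- hence `ft = fs ∘ σ^j`
  have hext : ft = fs.comp ((σ ^ j : L21 ≃ₐ[ℚ] L21) : L21 →+* L21) := by
    apply ringHom_ext_ζ
    simp only [RingHom.coe_comp, RingHom.coe_coe, Function.comp_apply]
    rw [σ_pow_ζ, map_pow, hfsa, hftb, ← pow_mul, hjb, ← μ_pow_mod]
  -- and `σ^j ∈ H` fixes `K` pointwise
  have hmem : σ ^ j ∈ IntermediateField.fixingSubgroup K6 := by
    rw [fixingSubgroup_K6]
    exact Subgroup.npow_mem_zpowers σ j
  rw [IntermediateField.mem_fixingSubgroup_iff] at hmem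
  refine RingHom.ext fun x ↦ ?_
  have hsx : s x = fs x := by rw [← hfs]; rfl
  have htx : t x = ft x := by rw [← hft]; rfl
  rw [hsx, htx, hext, RingHom.comp_apply]
  exact congrArg fs (hmem _ x.2).symm

/-- **The same, in the tree's group-theoretic sense**: for any base embedding `s₀`, the type is
`IsPrimitive (ℂ ≃+* ℂ) Φ s₀` (Shimura's `H₁ = H'`, `ReflexType.IsPrimitive`), via the tree's
`isPrimitive_ringEquiv_complex_iff`. [cite: Shimura1998, §8.2 Prop. 26, p. 61] -/
theorem isPrimitive_Φ (s₀ : K6 →+* ℂ) :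
    Literature.NumberTheory.ComplexMultiplication.IsPrimitive (ℂ ≃+* ℂ) Φ.1 s₀ :=
  (isPrimitive_ringEquiv_complex_iff Φ s₀).2 Φ_primitive

end Cyclotomic21

/-! ## §1 `End⁰ = K` for a simple principal realisation; isogenous realisations have comparable CM fields -/

section EndAlgebra

variable {K : Type} [Field K] [NumberField K] {Φ : CMType K}
  {A : AbelianVariety ℂ} {ι : 𝓞 K →+* End A} {θ : K →+* Module.End ℂ (complexBetti A.X 1)}
variable {K' : Type} [Field K'] [NumberField K'] {Φ' : CMType K'}
  {A' : AbelianVariety ℂ} {ι' : 𝓞 K' →+* End A'} {θ' : K' →+* Module.End ℂ (complexBetti A'.X 1)}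

/-- **`End⁰(A) ≅ K` for a SIMPLE principal realisation `(A, ι, θ)` of a CM type `(K; Φ)`** (Shimura §5.1
Props. 3, 4, 6: «the commutor of `F` in `End_ℚ(A)` coincides with `F`», «`End_ℚ(B) = K`»): the Serre–Tate map
`i : K → End⁰(A)` extending `ι` (`exists_ringHom_endAlgebra`) is injective (a ring map out of a field) and
`End⁰(A)` is a field of degree `2 dim A = [K : ℚ]` (`Milne1999.IsOfCMType.isOfCMTypeSimple`,
`Pohlmann1968.finrank_eq_two_mul_dim_of_isCMTypeRealisation`, `AbelianVariety.finiteDimensional_endAlgebra_holds`),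
so `i` is bijective by the dimension count. Code pattern of `CorCM.CMSixfoldRank.…Degenerate` §1.
[cite: Shimura1998, §5.1 Props. 3, 4, 6] [cite: SerreTate1968, §4] [cite: Milne1999, §2 p. 54] -/
theorem nonempty_ringEquiv_endAlgebra_of_isSimple (hA : IsCMTypeRealisation Φ A ι θ) (hs : A.IsSimple) :
    Nonempty (K ≃+* A.endAlgebra) := by
  obtain ⟨i, -⟩ := exists_ringHom_endAlgebra (A₀ := A) ι
  have hK2 : Module.finrank ℚ K = 2 * A.dim := finrank_eq_two_mul_dim_of_isCMTypeRealisation hA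
  have hpos : 0 < A.dim := by
    have h : 0 < Module.finrank ℚ K := Module.finrank_pos
    omega
  obtain ⟨hF, hrk⟩ := (isOfCMType_of_isCMTypeRealisation hA).isOfCMTypeSimple hs hpos
  haveI : Nontrivial A.endAlgebra := ⟨hF.exists_pair_ne⟩
  have hinj : Function.Injective i := i.injective
  have heq : Module.finrank ℚ K = Module.finrank ℚ A.endAlgebra := by rw [hrk, hK2]
  have hfin : Module.Finite ℚ A.endAlgebra := AbelianVariety.finiteDimensional_endAlgebra_holds A
  -- (`Module ℚ End⁰(A)` is found only through `Algebra ℚ End⁰(A)`: instances passed explicitly)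
  have hsurj : Function.Surjective i :=
    (@LinearMap.injective_iff_surjective_of_finrank_eq_finrank ℚ K _ _ _ A.endAlgebra _
      Algebra.toModule _ hfin heq i.toRatAlgHom.toLinearMap).1 hinj
  exact ⟨RingEquiv.ofBijective i ⟨hinj, hsurj⟩⟩

/-- **Isogenous ⇒ a ring map between the CM fields.** If `A` carries `ι : 𝓞_K → End(A)` and is isogenous to
a SIMPLE principal realisation `A'` of `(K'; Φ')`, then `K` embeds in `K'`:
`K → End⁰(A) ↪ End⁰(A') ≅ K'` (Serre–Tate `exists_ringHom_endAlgebra`; an isogeny transports `End⁰`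
injectively, Mumford §19 Remark p. 169 = the tree's `AbelianVariety.IsIsogeny.exists_algHom_injective`;
`nonempty_ringEquiv_endAlgebra_of_isSimple`). Used contrapositively: CM fields with `Hom(K, K') = ∅` force
non-isogeny. [cite: MumfordAV1970, §19 Remark p. 169 and pp. 172–174] [cite: Shimura1998, §5.1 Props. 3, 4, 6] -/
theorem nonempty_ringHom_of_isIsogenous (ι : 𝓞 K →+* End A) (hA' : IsCMTypeRealisation Φ' A' ι' θ')
    (hs' : A'.IsSimple) (h : AbelianVariety.IsIsogenous A A') : Nonempty (K →+* K') := by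
  obtain ⟨i, -⟩ := exists_ringHom_endAlgebra (A₀ := A) ι
  obtain ⟨f, hf⟩ := h
  obtain ⟨⟨Θ, -⟩, -⟩ := hf.exists_algHom_injective
  obtain ⟨e'⟩ := nonempty_ringEquiv_endAlgebra_of_isSimple hA' hs'
  exact ⟨e'.symm.toRingHom.comp (Θ.toRingHom.comp i)⟩

end EndAlgebra

/-! ## §2 The witness pair and the cell theorems -/

/-- **The typed class of the open `Y₃ × Y₃'` cell is NOT EMPTY on its CM locus (given H₃).** There are simple
complex abelian THREEFOLDS `Y`, `Y'` of CM type, NOT isogenous, with `ψ ∘ ψ = -3` on `Y` and `ψ' ∘ ψ' = -3`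
on `Y'` — every binder of `HodgeUnitaryThreefoldPair` with `d = 3`, plus `IsOfCMType Y ∧ IsOfCMType Y'`.
`Y` realises `(ℚ(ζ₉); {1, 2, 4})`, `Y'` realises `(K; S)`, `K ⊂ ℚ(ζ₂₁)` (both types primitive, hence `Y`,
`Y'` simple; `ψ, ψ' = ι(2ζ₃ + 1)`); an isogeny would embed `ℚ(ζ₉)` in `K ⊂ ℚ(ζ₂₁)`
(`nonempty_ringHom_of_isIsogenous`), which `Cyclotomic21.not_nonempty_ringHom_cyclotomicNine` forbids.
[cite: Shimura1998, §5.1 Props. 3, 4, 6, §8.2 Prop. 26, §8.4 Example (1)] [cite: MumfordAV1970, §19] -/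
theorem hodgeUnitaryThreefoldPair_class_nonempty (h₃ : PicardCM.CMAbelianVarietyRealised) :
    ∃ (Y Y' : AbelianVariety ℂ) (ψ : Y ⟶ Y) (ψ' : Y' ⟶ Y') (d : ℕ), 0 < d ∧ Y.dim = 3 ∧ Y'.dim = 3 ∧
      Y.IsSimple ∧ Y'.IsSimple ∧ ¬ AbelianVariety.IsIsogenous Y Y' ∧
      ψ ≫ ψ = -(d • 𝟙 Y) ∧ ψ' ≫ ψ' = -(d • 𝟙 Y') ∧ IsOfCMType Y ∧ IsOfCMType Y' := by
  obtain ⟨Y, ι, θ, hY⟩ := h₃ Cyclotomic9.K9 Cyclotomic9.Φ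
  obtain ⟨Y', ι', θ', hY'⟩ := h₃ Cyclotomic21.K6 Cyclotomic21.Φ
  have hR : IsCMTypeRealisation Cyclotomic9.Φ Y ι θ := hY
  have hR' : IsCMTypeRealisation Cyclotomic21.Φ Y' ι' θ' := hY'
  have hs : Y.IsSimple := isSimple_of_isCMTypeRealisation_of_primitive hR Cyclotomic9.Φ_primitive
  have hs' : Y'.IsSimple := isSimple_of_isCMTypeRealisation_of_primitive hR' Cyclotomic21.Φ_primitive
  have hdim : Y.dim = Module.finrank ℚ Cyclotomic9.K9 / 2 := Motives.schemeDim_eq_holds hR.1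
  have hdim' : Y'.dim = Module.finrank ℚ Cyclotomic21.K6 / 2 := Motives.schemeDim_eq_holds hR'.1
  have hω := Cyclotomic9.isPrimitiveRoot_zeta3
  have hω' := Cyclotomic21.isPrimitiveRoot_zeta3K
  refine ⟨Y, Y', ι (2 * hω.toInteger + 1), ι' (2 * hω'.toInteger + 1), 3, by norm_num,
    by rw [hdim, Cyclotomic9.finrank_K9], by rw [hdim', Cyclotomic21.finrank_K6], hs, hs', ?_, ?_, ?_,
    isOfCMType_of_isCMTypeRealisation hR, isOfCMType_of_isCMTypeRealisation hR'⟩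
  · intro hiso
    obtain ⟨f⟩ := nonempty_ringHom_of_isIsogenous ι hR' hs' hiso
    exact Cyclotomic21.not_nonempty_ringHom_cyclotomicNine (F := Cyclotomic9.K9)
      ⟨(algebraMap Cyclotomic21.K6 Cyclotomic21.L21).comp f⟩
  · change ι (2 * hω.toInteger + 1) * ι (2 * hω.toInteger + 1) = -((3 : ℕ) • (1 : End Y))
    rw [← map_mul, Cyclotomic3.two_mul_add_one_mul_self hω.toInteger_isPrimitiveRoot, map_neg, map_ofNat,
      nsmul_eq_mul, Nat.cast_ofNat, mul_one]
  · change ι' (2 * hω'.toInteger + 1) * ι' (2 * hω'.toInteger + 1) = -((3 : ℕ) • (1 : End Y'))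
    rw [← map_mul, Cyclotomic3.two_mul_add_one_mul_self hω'.toInteger_isPrimitiveRoot, map_neg, map_ofNat,
      nsmul_eq_mul, Nat.cast_ofNat, mul_one]

/-- **The same, OUTRIGHT**: H₃ is the tree theorem `CorCM.cmAbelianVarietyRealised_holds` (the complex-torus
model `ℂ^Φ/Φ(𝓞_K)`), imported by name. [cite: Shimura1998, §6.2 Thm. 3 (p. 46) with §3.1 Thm. 3 (p. 26)] -/
theorem hodgeUnitaryThreefoldPair_class_nonempty' :
    ∃ (Y Y' : AbelianVariety ℂ) (ψ : Y ⟶ Y) (ψ' : Y' ⟶ Y') (d : ℕ), 0 < d ∧ Y.dim = 3 ∧ Y'.dim = 3 ∧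
      Y.IsSimple ∧ Y'.IsSimple ∧ ¬ AbelianVariety.IsIsogenous Y Y' ∧
      ψ ≫ ψ = -(d • 𝟙 Y) ∧ ψ' ≫ ψ' = -(d • 𝟙 Y') ∧ IsOfCMType Y ∧ IsOfCMType Y' :=
  hodgeUnitaryThreefoldPair_class_nonempty cmAbelianVarietyRealised_holds

/-- **The cell does not quantify over the empty set.** If the OPEN cell `HodgeUnitaryThreefoldPair` is ever
proved, it yields HC for an ACTUAL abelian sixfold of CM type (`Y × Y'` of the witness pair; `dim = 3 + 3`,
`AbelianVariety.dim_prod`; CM type is closed under products, `IsOfCMType.prod`). Outright.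
[cite: MoonenZarhin1999, Thm. 0.1 (iv)] -/
theorem HodgeUnitaryThreefoldPair.exists_cmSixfold (h : HodgeUnitaryThreefoldPair) :
    ∃ X : AbelianVariety ℂ, X.dim = 6 ∧ IsOfCMType X ∧ HodgeConjectureFor X.dim X.X := by
  obtain ⟨Y, Y', ψ, ψ', d, hd, hY, hY', hs, hs', hni, hψ, hψ', hYcm, hY'cm⟩ :=
    hodgeUnitaryThreefoldPair_class_nonempty'
  exact ⟨Y.prod Y', by rw [AbelianVariety.dim_prod, hY, hY'], hYcm.prod hY'cm,
    h Y Y' ψ ψ' d hd hY hY' hs hs' hni hψ hψ'⟩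

/-- **Under HC_CM (an explicit hypothesis), HC holds for an actual member of the open cell's class**: the CM
locus of `HodgeUnitaryThreefoldPair` (generation 50's `hodgeUnitaryThreefoldPair_cmLocus_of_cmAbelianHodge`) is
inhabited by the witness pair. `HC_CM = Theses.RankFourFaces.CMAbelianHodge` is the ARGUMENT `hCM`; nothing is
claimed for the cell's generic (non-CM) member. [cite: MoonenZarhin1999, Thm. 0.1 (iv) and §6] -/
theorem hodgeUnitaryThreefoldPair_cmLocus_nonempty_of_cmAbelianHodge
    (hCM : Theses.RankFourFaces.CMAbelianHodge) :
    ∃ (Y Y' : AbelianVariety ℂ) (ψ : Y ⟶ Y) (ψ' : Y' ⟶ Y') (d : ℕ), 0 < d ∧ Y.dim = 3 ∧ Y'.dim = 3 ∧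
      Y.IsSimple ∧ Y'.IsSimple ∧ ¬ AbelianVariety.IsIsogenous Y Y' ∧
      ψ ≫ ψ = -(d • 𝟙 Y) ∧ ψ' ≫ ψ' = -(d • 𝟙 Y') ∧ IsOfCMType Y ∧ IsOfCMType Y' ∧
      HodgeConjectureFor (Y.prod Y').dim (Y.prod Y').X := by
  obtain ⟨Y, Y', ψ, ψ', d, hd, hY, hY', hs, hs', hni, hψ, hψ', hYcm, hY'cm⟩ :=
    hodgeUnitaryThreefoldPair_class_nonempty'
  exact ⟨Y, Y', ψ, ψ', d, hd, hY, hY', hs, hs', hni, hψ, hψ', hYcm, hY'cm,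
    hodgeUnitaryThreefoldPair_cmLocus_of_cmAbelianHodge hCM Y Y' ψ ψ' d hd hY hY' hs hs' hni hψ hψ' hYcm hY'cm⟩

end Summit.HodgeConjecture.HodgeConjecture.Ring2.Atlas

end
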